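import Summits.ValiantsHypothesis.ValiantsHypothesis.Theorems.KPlusLogSqLawTropicalBShadowCeilingBridge
import Summits.ValiantsHypothesis.ValiantsHypothesis.Theorems.LacunarySymmetroidMatrixDescartesCensusTropicalKLawSlopes

/-!
# Route «KPlusLogSqLaw», crux `TropicalB` (stmt-ValiantsHypothesis-19771) — the attack foothold `stub_tropTowerLog` and the fat
# strip `⌊√m⌋(⌊log₂ m⌋+1) ≤ K` of `TropicalB` from ANY separating-shadow ceiling of the shape `(m+2)^{c(⌊√m⌋+1)}`

HONEST FRAMING.  Def-free helper toward the registered stubs of the crux `TropicalB` (`--supports stmt-ValiantsHypothesis-19771`),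
sequel of `…TropicalBShadowCeilingBridge` (bridge: a static sign-alternating dominant chain of length `n+1` on `m` nodes gives an
integral separating pair `(a, b)` all of whose realising linear shadows of `DS_m` have `≥ n+1` vertices).  Nothing here asserts
`TropicalB`, `KPlusLogSqLaw`, `MatrixDescartes` or anything on VP ≠ VNP: every statement is an implication from an explicit
shadow-ceiling HYPOTHESIS, or arithmetic.  The hypothesis shape is exactly the tree's conjecture
`…Theorems.SeparatingShadowCeiling` (`|vert intProj a b (DS_m)| ≤ (m+2)^{c(⌊√m⌋+1)}` for separating integral `(a, b)`;
implied by `KPTT.newtonTauWeak`, `…Theorems.separatingShadowCeiling_of_newtonTauWeak`, Hrubeš–Yehudayoff 2021 fn. 1 / Forbes);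
the instantiation `L := intProj a b` (`…Theorems.intProj_permMatrix`) is left to a five-line sequel importing `…SoloBlindShadowCeiling`.

* `tropRootLawAt_of_shadow_bound` — a vertex bound `B + 1` for all separating integral shadows on `m` nodes gives, through the
  SAME-SIZE static reduction `TropicalCensus.tropRootLawAt_of_static`, `T(m, K) ≤ (m²(K−1)+1)(B+1) − 1` for every `K`;
* `rowBound_of_ceilingShape` — under a ceiling of shape `(m+2)^{c(⌊√m⌋+1)}`: `T(m,K) ≤ (m²(K−1)+1)(m+2)^{c(⌊√m⌋+1)} − 1`,
  i.e. `log₂ T(m, K) = O(√m·log m + log K)` for EVERY `K`;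
* `fatStrip_of_rowBound` — hence `⌊√m⌋(⌊log₂ m⌋+1) ≤ K → T(m, K) ≤ 2^{(6c+7)K}`: the registered fat stub `stub_tropFat`
  (`⌊log₂ m⌋² ≤ K → T ≤ 2^{CK}`) shrinks, under the ceiling, to the strip `⌊log₂ m⌋² ≤ K < ⌊√m⌋(⌊log₂ m⌋+1)`;
* `towerLog_of_rowBound` — and `T(K⌊log₂K⌋, K) ≤ 2^{(18c+7)K}` for all `K`: the ATTACK FOOTHOLD `stub_tropTowerLog` of
  `Cruxes/TropicalB/Lines/birth.lean` (its `TropRow` is δ-equal to `TropRootLawAt`) holds under the ceiling — so a refutation of the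
  foothold (a `K`-slope family on `K log K` nodes beating every `2^{CK}`) refutes every such ceiling, hence `newtonTauWeak`.
[folklore] arithmetic; the located remark is Hrubeš–Yehudayoff 2021 (doi:10.4230/LIPIcs.CCC.2021.9) p. 9:2 footnote 1.
-/

set_option linter.dupNamespace false
set_option autoImplicit false

namespace Summit.ValiantsHypothesis.ValiantsHypothesis.Theorems.KPlusLogSqLaw.ShadowCeilingBridge

open Summit.ValiantsHypothesis.ValiantsHypothesis.Theorems.MatrixDescartes.Negative
open Summit.ValiantsHypothesis.ValiantsHypothesis.Theorems.LacunarySymmetroidMatrixDescartes.TropicalCensus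
open Literature.Computability.AlgebraicComplexity (permMatrixPoints birkhoffShadowVertexCount)
open Finset

/-! ## 1. A shadow vertex bound at size `m` bounds the tropical row `(m, K)` for every `K` -/

/-- **Shadow bound ⇒ tropical row.**  If every linear shadow of `DS_m` realising a separating integral pair has at most `B + 1`
vertices, then `T(m, K) ≤ (m²(K−1)+1)(B+1) − 1` for every `K` (bridge + same-size static reduction). [folklore] -/
theorem tropRootLawAt_of_shadow_bound {m B : ℕ} (K : ℕ)
    (h : ∀ a b : Fin m × Fin m → ℕ,
      Function.Injective (fun ρ : Equiv.Perm (Fin m) => (∑ j, a (ρ j, j), ∑ j, b (ρ j, j))) →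
      ∃ L : (Fin m × Fin m → ℝ) →ₗ[ℝ] (Fin 2 → ℝ),
        (∀ ρ : Equiv.Perm (Fin m), L (fun ij => if ρ ij.2 = ij.1 then 1 else 0) =
          fun i : Fin 2 => if i = 0 then ((∑ j, a (ρ j, j) : ℕ) : ℝ) else ((∑ j, b (ρ j, j) : ℕ) : ℝ)) ∧
        birkhoffShadowVertexCount L ≤ B + 1) :
    TropRootLawAt m K ((m * m * (K - 1) + 1) * (B + 1) - 1) :=
  tropRootLawAt_of_static (tropRootLawAtStatic_of_shadow_bound h)

/-- **Ceiling shape ⇒ row bound.**  A separating-shadow ceiling of the shape `(m+2)^{c(⌊√m⌋+1)}` (the shape of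
`SeparatingShadowCeiling`) gives `T(m, K) ≤ (m²(K−1)+1)(m+2)^{c(⌊√m⌋+1)} − 1` for all `m, K`. [folklore] -/
theorem rowBound_of_ceilingShape (c : ℕ)
    (h : ∀ (m : ℕ) (a b : Fin m × Fin m → ℕ),
      Function.Injective (fun ρ : Equiv.Perm (Fin m) => (∑ j, a (ρ j, j), ∑ j, b (ρ j, j))) →
      ∃ L : (Fin m × Fin m → ℝ) →ₗ[ℝ] (Fin 2 → ℝ),
        (∀ ρ : Equiv.Perm (Fin m), L (fun ij => if ρ ij.2 = ij.1 then 1 else 0) =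
          fun i : Fin 2 => if i = 0 then ((∑ j, a (ρ j, j) : ℕ) : ℝ) else ((∑ j, b (ρ j, j) : ℕ) : ℝ)) ∧
        birkhoffShadowVertexCount L ≤ (m + 2) ^ (c * (Nat.sqrt m + 1))) (m K : ℕ) :
    TropRootLawAt m K ((m * m * (K - 1) + 1) * (m + 2) ^ (c * (Nat.sqrt m + 1)) - 1) := by
  have hpos : 1 ≤ (m + 2) ^ (c * (Nat.sqrt m + 1)) := Nat.one_le_pow _ _ (by omega)
  have h1 := tropRootLawAt_of_shadow_bound (m := m) (B := (m + 2) ^ (c * (Nat.sqrt m + 1)) - 1) K (fun a b hab => by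
    obtain ⟨L, hL, hLB⟩ := h m a b hab
    exact ⟨L, hL, by omega⟩)
  rwa [Nat.sub_add_cancel hpos] at h1

/-! ## 2. Arithmetic: the ceiling bound is `2^{O(K)}` on the fat strip and at the tower `m = K⌊log₂ K⌋` -/

/-- `(L+1)³ ≤ 8·2^L`. [folklore] -/
theorem cube_le_eight_mul_two_pow (L : ℕ) : (L + 1) ^ 3 ≤ 8 * 2 ^ L := by
  induction L with
  | zero => norm_num
  | succ L ih =>
    rcases Nat.lt_or_ge L 3 with hL | hL
    · interval_cases L <;> norm_num
    · have h9 : 9 * L ≤ L * L * L := Nat.mul_le_mul_right L (by nlinarith)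
      have h1 : (L + 1 + 1) ^ 3 ≤ 2 * (L + 1) ^ 3 := by nlinarith [h9]
      calc (L + 1 + 1) ^ 3 ≤ 2 * (L + 1) ^ 3 := h1
        _ ≤ 2 * (8 * 2 ^ L) := by omega
        _ = 8 * 2 ^ (L + 1) := by ring

/-- `(⌊√m⌋+1)² ≤ 2m + 2`. [folklore] -/
theorem sqrt_succ_sq_le (m : ℕ) : (Nat.sqrt m + 1) ^ 2 ≤ 2 * m + 2 := by
  have h := Nat.sqrt_le' m
  nlinarith [Nat.zero_le (Nat.sqrt m)]

/-- the polynomial prefactor in bits: `m·m·(K−1) + 1 ≤ (m+2)²·2^K`. [folklore] -/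
theorem prefactor_le (m K : ℕ) : m * m * (K - 1) + 1 ≤ (m + 2) ^ 2 * 2 ^ K := by
  have h1 : K - 1 ≤ 2 ^ K := (Nat.sub_le K 1).trans Nat.lt_two_pow_self.le
  have h2 : 1 ≤ 2 ^ K := Nat.one_le_two_pow
  calc m * m * (K - 1) + 1 ≤ m * m * 2 ^ K + 2 ^ K := by gcongr
    _ = (m * m + 1) * 2 ^ K := by ring
    _ ≤ (m + 2) ^ 2 * 2 ^ K := by gcongr; nlinarith

/-- **the ceiling bound in bits**: `(m²(K−1)+1)(m+2)^{c(⌊√m⌋+1)} ≤ 2^{K + (⌊log₂ m⌋+2)(c(⌊√m⌋+1)+2)}`. [folklore] -/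
theorem ceilingBound_le_two_pow (c m K : ℕ) :
    (m * m * (K - 1) + 1) * (m + 2) ^ (c * (Nat.sqrt m + 1)) ≤
      2 ^ (K + (Nat.log 2 m + 2) * (c * (Nat.sqrt m + 1) + 2)) := by
  -- size in bits: `m + 2 ≤ 2^{⌊log₂ m⌋ + 2}` (as in `Literature…add_two_le_two_pow_log`, inlined to keep imports light)
  have hm : m + 2 ≤ 2 ^ (Nat.log 2 m + 2) := by
    have h := Nat.lt_pow_succ_log_self (b := 2) (by norm_num) m
    have h2 : 2 ≤ 2 ^ (Nat.log 2 m + 1) := by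
      calc 2 = 2 ^ 1 := by norm_num
        _ ≤ 2 ^ (Nat.log 2 m + 1) := Nat.pow_le_pow_right (by norm_num) (by omega)
    calc m + 2 ≤ 2 ^ (Nat.log 2 m + 1) + 2 ^ (Nat.log 2 m + 1) := by omega
      _ = 2 ^ (Nat.log 2 m + 2) := by ring
  calc (m * m * (K - 1) + 1) * (m + 2) ^ (c * (Nat.sqrt m + 1))
      ≤ ((m + 2) ^ 2 * 2 ^ K) * (m + 2) ^ (c * (Nat.sqrt m + 1)) := by gcongr; exact prefactor_le m K
    _ = 2 ^ K * (m + 2) ^ (c * (Nat.sqrt m + 1) + 2) := by ring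
    _ ≤ 2 ^ K * (2 ^ (Nat.log 2 m + 2)) ^ (c * (Nat.sqrt m + 1) + 2) := by gcongr
    _ = 2 ^ (K + (Nat.log 2 m + 2) * (c * (Nat.sqrt m + 1) + 2)) := by rw [← pow_mul, ← pow_add]

/-- **fat-strip exponent**: if `⌊√m⌋(⌊log₂ m⌋+1) ≤ K` and `1 ≤ K` then the exponent is `≤ (6c+7)·K`. [folklore] -/
theorem stripExponent_le (c m K : ℕ) (hK : Nat.sqrt m * (Nat.log 2 m + 1) ≤ K) (hK1 : 1 ≤ K) :
    K + (Nat.log 2 m + 2) * (c * (Nat.sqrt m + 1) + 2) ≤ (6 * c + 7) * K := by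
  set s := Nat.sqrt m with hs
  set L := Nat.log 2 m with hL
  have hL1 : L + 1 ≤ K := by
    rcases Nat.eq_zero_or_pos m with hm | hm
    · have : L = 0 := by rw [hL, hm]; simp
      omega
    · have hs1 : 1 ≤ s := by rw [hs]; exact Nat.succ_le_of_lt (Nat.sqrt_pos.mpr hm)
      nlinarith
  have h1 : (L + 1) * (s + 1) ≤ 2 * K + 1 := by nlinarith
  have h2a : (L + 2) * (c * (s + 1)) ≤ 2 * (L + 1) * (c * (s + 1)) := Nat.mul_le_mul_right _ (by omega)
  have h2 : (L + 2) * (c * (s + 1) + 2) ≤ 2 * (c * ((L + 1) * (s + 1))) + 2 * (L + 2) := by nlinarith [h2a]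
  have h3 : 2 * (c * ((L + 1) * (s + 1))) ≤ 2 * (c * (2 * K + 1)) := by gcongr
  have h4 : 2 * c ≤ 2 * c * K := Nat.le_mul_of_pos_right _ hK1
  nlinarith [h2, h3, h4, hL1]

/-- **tower exponent**: at `m = K⌊log₂ K⌋` with `1 ≤ K` the exponent is `≤ (18c+7)·K`. [folklore] -/
theorem towerExponent_le (c K : ℕ) (hK1 : 1 ≤ K) :
    K + (Nat.log 2 (K * Nat.log 2 K) + 2) * (c * (Nat.sqrt (K * Nat.log 2 K) + 1) + 2) ≤ (18 * c + 7) * K := by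
  set L := Nat.log 2 K with hL
  set m := K * L with hm
  set s := Nat.sqrt m with hs
  set L' := Nat.log 2 m with hL'
  have h2L : 2 ^ L ≤ K := by rw [hL]; exact Nat.pow_log_le_self 2 (by omega)
  have hcube : (L + 1) ^ 3 ≤ 8 * K := (cube_le_eight_mul_two_pow L).trans (by omega)
  have hsq3 : (L + 1) ^ 2 ≤ (L + 1) ^ 3 := Nat.pow_le_pow_right (by omega) (by norm_num)
  have hs2 : (s + 1) ^ 2 ≤ 2 * m + 2 := sqrt_succ_sq_le m
  -- `((L+1)(s+1))² ≤ (4K+2)²`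
  have hprod2 : ((L + 1) * (s + 1)) ^ 2 ≤ (4 * K + 2) ^ 2 := by
    have e3 : (L + 1) ^ 2 * L ≤ (L + 1) ^ 3 := by nlinarith
    calc ((L + 1) * (s + 1)) ^ 2 = (L + 1) ^ 2 * (s + 1) ^ 2 := by ring
      _ ≤ (L + 1) ^ 2 * (2 * m + 2) := by gcongr
      _ = 2 * K * ((L + 1) ^ 2 * L) + 2 * (L + 1) ^ 2 := by rw [hm]; ring
      _ ≤ 2 * K * (8 * K) + 2 * (8 * K) :=
          Nat.add_le_add (Nat.mul_le_mul_left _ (e3.trans hcube)) (Nat.mul_le_mul_left _ (hsq3.trans hcube))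
      _ ≤ (4 * K + 2) ^ 2 := by nlinarith
  have hprod : (L + 1) * (s + 1) ≤ 4 * K + 2 := (Nat.pow_le_pow_iff_left (by norm_num)).mp hprod2
  -- `L' + 2 ≤ 3(L+1)`: `m ≤ K·K < 2^{2L+2}`
  have hL'le : L' + 2 ≤ 3 * (L + 1) := by
    have hKlt : K < 2 ^ (L + 1) := by rw [hL]; exact Nat.lt_pow_succ_log_self (by norm_num) K
    have hLK : L ≤ K := by rw [hL]; exact Nat.log_le_self 2 K
    have hmlt : m < 2 ^ (2 * L + 2) := by
      calc m ≤ K * K := by rw [hm]; exact Nat.mul_le_mul_left K hLK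
        _ < 2 ^ (L + 1) * 2 ^ (L + 1) := Nat.mul_lt_mul'' hKlt hKlt
        _ = 2 ^ (2 * L + 2) := by rw [← pow_add]; ring_nf
    have : L' < 2 * L + 2 := by
      rw [hL']
      rcases Nat.eq_zero_or_pos m with h0 | h0
      · rw [h0]; simp
      · exact Nat.log_lt_of_lt_pow h0.ne' hmlt
    omega
  have h3 : (L' + 2) * (c * (s + 1) + 2) ≤ 3 * (L + 1) * (c * (s + 1) + 2) := Nat.mul_le_mul_right _ hL'le
  have h4 : 3 * (L + 1) * (c * (s + 1) + 2) = 3 * (c * ((L + 1) * (s + 1))) + 6 * (L + 1) := by ring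
  have h5 : L + 1 ≤ K := by
    have : L < 2 ^ L := Nat.lt_two_pow_self
    omega
  have h6 : 3 * (c * ((L + 1) * (s + 1))) ≤ 3 * (c * (4 * K + 2)) := by gcongr
  have h7 : 6 * c ≤ 6 * c * K := Nat.le_mul_of_pos_right _ hK1
  nlinarith [h3, h4, h5, h6, h7]

/-! ## 3. The foothold and the fat strip under a ceiling of the `SeparatingShadowCeiling` shape -/

/-- size zero: no alternation at all (`T(0, K) = 0`). [folklore] -/
theorem tropRootLawAt_size_zero (K B : ℕ) : TropRootLawAt 0 K B := by
  have h := tropRootLawAt_slopeCount 0 K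
  rw [Nat.multichoose_zero_right] at h
  exact tropRootLawAt_mono (by omega) h

/-- **The fat strip.**  From the row bound of shape `(m²(K−1)+1)(m+2)^{c(⌊√m⌋+1)} − 1` (i.e. under a separating-shadow ceiling
of shape `(m+2)^{c(⌊√m⌋+1)}`, `rowBound_of_ceilingShape`): `⌊√m⌋(⌊log₂ m⌋+1) ≤ K → T(m, K) ≤ 2^{(6c+7)·K}`. [folklore] -/
theorem fatStrip_of_rowBound (c : ℕ)
    (hc : ∀ m K : ℕ, TropRootLawAt m K ((m * m * (K - 1) + 1) * (m + 2) ^ (c * (Nat.sqrt m + 1)) - 1)) (m K : ℕ)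
    (hK : Nat.sqrt m * (Nat.log 2 m + 1) ≤ K) : TropRootLawAt m K (2 ^ ((6 * c + 7) * K)) := by
  rcases Nat.eq_zero_or_pos K with hK0 | hK1
  · subst hK0
    have hs : Nat.sqrt m = 0 := by
      rcases Nat.eq_zero_or_pos (Nat.sqrt m) with h0 | h0
      · exact h0
      · exfalso
        have : 1 ≤ Nat.sqrt m * (Nat.log 2 m + 1) := Nat.le_mul_of_pos_left _ h0 |>.trans' (by omega)
        omega
    have hm : m = 0 := Nat.sqrt_eq_zero.mp hs
    subst hm
    exact tropRootLawAt_size_zero 0 _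
  · refine tropRootLawAt_mono ?_ (hc m K)
    calc (m * m * (K - 1) + 1) * (m + 2) ^ (c * (Nat.sqrt m + 1)) - 1
        ≤ (m * m * (K - 1) + 1) * (m + 2) ^ (c * (Nat.sqrt m + 1)) := Nat.sub_le _ _
      _ ≤ 2 ^ (K + (Nat.log 2 m + 2) * (c * (Nat.sqrt m + 1) + 2)) := ceilingBound_le_two_pow c m K
      _ ≤ 2 ^ ((6 * c + 7) * K) := Nat.pow_le_pow_right (by norm_num) (stripExponent_le c m K hK hK1)

/-- **THE ATTACK FOOTHOLD UNDER THE CEILING.**  From the same row bound: `T(K⌊log₂K⌋, K) ≤ 2^{(18c+7)·K}` for every `K` —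
the registered stub `stub_tropTowerLog` (`∃ C, ∀ K, TropRow (K * Nat.log 2 K) K (2 ^ (C * K))`, `TropRow` δ-equal to
`TropRootLawAt`), CONDITIONALLY on a separating-shadow ceiling of the `SeparatingShadowCeiling` shape. [folklore] -/
theorem towerLog_of_rowBound (c : ℕ)
    (hc : ∀ m K : ℕ, TropRootLawAt m K ((m * m * (K - 1) + 1) * (m + 2) ^ (c * (Nat.sqrt m + 1)) - 1)) (K : ℕ) :
    TropRootLawAt (K * Nat.log 2 K) K (2 ^ ((18 * c + 7) * K)) := by
  rcases Nat.eq_zero_or_pos K with hK0 | hK1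
  · subst hK0
    exact tropRootLawAt_size_zero 0 _
  · refine tropRootLawAt_mono ?_ (hc (K * Nat.log 2 K) K)
    calc (K * Nat.log 2 K * (K * Nat.log 2 K) * (K - 1) + 1) *
          (K * Nat.log 2 K + 2) ^ (c * (Nat.sqrt (K * Nat.log 2 K) + 1)) - 1
        ≤ (K * Nat.log 2 K * (K * Nat.log 2 K) * (K - 1) + 1) *
            (K * Nat.log 2 K + 2) ^ (c * (Nat.sqrt (K * Nat.log 2 K) + 1)) := Nat.sub_le _ _
      _ ≤ 2 ^ (K + (Nat.log 2 (K * Nat.log 2 K) + 2) * (c * (Nat.sqrt (K * Nat.log 2 K) + 1) + 2)) :=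
          ceilingBound_le_two_pow c (K * Nat.log 2 K) K
      _ ≤ 2 ^ ((18 * c + 7) * K) := Nat.pow_le_pow_right (by norm_num) (towerExponent_le c K hK1)

/-- **Packaged**: a separating-shadow ceiling of shape `(m+2)^{c(⌊√m⌋+1)}` implies the foothold statement
`∃ C, ∀ K, T(K⌊log₂K⌋, K) ≤ 2^{C·K}` and the fat-strip law `∃ C, ∀ m K, ⌊√m⌋(⌊log₂ m⌋+1) ≤ K → T(m,K) ≤ 2^{C·K}`. [folklore] -/
theorem towerLog_and_fatStrip_of_ceilingShape (c : ℕ)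
    (h : ∀ (m : ℕ) (a b : Fin m × Fin m → ℕ),
      Function.Injective (fun ρ : Equiv.Perm (Fin m) => (∑ j, a (ρ j, j), ∑ j, b (ρ j, j))) →
      ∃ L : (Fin m × Fin m → ℝ) →ₗ[ℝ] (Fin 2 → ℝ),
        (∀ ρ : Equiv.Perm (Fin m), L (fun ij => if ρ ij.2 = ij.1 then 1 else 0) =
          fun i : Fin 2 => if i = 0 then ((∑ j, a (ρ j, j) : ℕ) : ℝ) else ((∑ j, b (ρ j, j) : ℕ) : ℝ)) ∧
        birkhoffShadowVertexCount L ≤ (m + 2) ^ (c * (Nat.sqrt m + 1))) :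
    (∃ C : ℕ, ∀ K : ℕ, TropRootLawAt (K * Nat.log 2 K) K (2 ^ (C * K))) ∧
    (∃ C : ℕ, ∀ m K : ℕ, Nat.sqrt m * (Nat.log 2 m + 1) ≤ K → TropRootLawAt m K (2 ^ (C * K))) :=
  ⟨⟨18 * c + 7, towerLog_of_rowBound c (rowBound_of_ceilingShape c h)⟩,
   ⟨6 * c + 7, fatStrip_of_rowBound c (rowBound_of_ceilingShape c h)⟩⟩

end Summit.ValiantsHypothesis.ValiantsHypothesis.Theorems.KPlusLogSqLaw.ShadowCeilingBridge
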